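import Literature.AlgebraicGeometry.Resolution.CurveCentreNearPointDimension
import Literature.AlgebraicGeometry.Resolution.StrictNormalCrossingsFlatDescent
import Literature.AlgebraicGeometry.Resolution.RegularCentreRsopPart
import Literature.AlgebraicGeometry.Resolution.BlowupsIntegral
import Literature.AlgebraicGeometry.Resolution.MonomialOrderReductionUnit
import Literature.AlgebraicGeometry.Resolution.StalkIdealLemmas
import Literature.AlgebraicGeometry.Resolution.BlowupChartOriginKernel
import Literature.AlgebraicGeometry.Resolution.NormalCrossingsBlowupStepReduction
import Literature.RingTheory.RegularLocalRing.QuotientDVR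
import HarnessLib

/-!
# The strict transform of a curve transverse to a regular centre — LOCAL form
# (CoP1, Prop. 4.4, p. 10: "the strict transform of `Σ` in `X′` is transverse to the exceptional divisor")

[AI: prover `res-inputs-p-5a` (cell res-hironaka, F-71 census row L2 / glue (g1)); the POINTWISE companion of
`exists_isRsopPart_strictTransform_of_transverse` (`StrictTransformTransverseCurve.lean`, res-inputs-p-8a, which assumes the
curve regular at ALL its points): here the curve `C` is only assumed cut out by an rsop pair, transverse to the centre, AT the
image point `π c′`. This is what step 2 of the algorithm of Prop. 4.4 needs: a curve of `Σ` regular at the blown-up point but possibly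
singular elsewhere. Proof by the chart at `c′` (no global comparison `C̃ ≅ C`). Not a statement of the manuscript under adjudication;
AI-written, AI review is weaker than expert review.]

**Statement.** `X` regular locally Noetherian, `π : X′ → X` the blowing up of a regular closed `Y` (`IsBlowup π 𝓘_Y`), `C ⊄ Y`
closed irreducible, `c′ ∈ C̃ := cl(π⁻¹(C ∖ Y))`, and AT `x = π c′`: `𝓘_{C,x}` is generated by a pair that is part of a regular system
of parameters, and if `x ∈ Y` then `𝓘_{C,x} + 𝓘_{Y,x} = 𝔪_x` and `dim 𝒪_{X,x} = 3`. THEN `𝓘_{C̃,c′}` is generated by an rsop pair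
of `𝒪_{X′,c′}`, and if `x ∈ Y` then `𝓘_{C̃,c′} + 𝓘_Y 𝒪_{X′,c′} = 𝔪_{c′}`.

**Proof.** `C̃ = cl{η̃}` for the point `η̃` over the generic point `η` of `C` (the blowing up is an isomorphism off `Y`), so
`𝓘_{C̃,c′}` is the kernel of `𝒪_{X′,c′} → κ(η̃)` and `𝓘_{C,x}` that of `𝒪_{X,x} → κ(η)`; off `Y` the stalk map is an isomorphism.
Over `x ∈ C ∩ Y`: `D = 𝒪_{X,x}/𝓘_{C,x}` is a discrete valuation ring with `𝔪_D = 𝓘_Y D` (transversality), so after a shear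
(`isRsopPart_shiftRsop`) the centre is `(q_j, q_i)` with `q_i ∈ 𝓘_{C,x}` (`i ≠ j`) and `q_j` a uniformizer of `D`
(`exists_span_singleton_eq_maximalIdeal_of_span_range_eq`); then `c′` is the origin of the `q_j`-chart
(`IsBlowup.exists_reesChart_stalk`) and `exists_isRsopPart_span_eq_ker_of_origin` (`BlowupChartOriginKernel.lean`) gives
`𝓘_{C̃,c′} = (q_i/q_j, w)` with `(q_j, q_i/q_j, w)` regular parameters. [cite: CossartPiltant2008, Prop. 4.4 (proof, p. 10)]
-/

noncomputable section

open CategoryTheory CategoryTheory.Limits AlgebraicGeometry TopologicalSpace IsLocalRing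

namespace Literature.AlgebraicGeometry.Resolution

universe u

open Scheme.IdealSheafData

/-! ## Scheme level: the strict transform of a transverse regular curve -/

section Scheme

/-- **[CoP1] Prop. 4.4, p. 10 — the strict transform of a curve transverse to the centre, LOCAL form.** For the
blowing up `π` of the regular locally Noetherian `X` along a regular closed `Y` and an irreducible closed `C ⊄ Y`, at a
point `c′` of the strict transform `C̃ = cl(π⁻¹(C ∖ Y))` over `x = π c′` where `𝓘_{C,x}` is generated by a pair that is
part of a regular system of parameters and — if `x ∈ Y` — transverse to `Y` (`𝓘_{C,x} + 𝓘_{Y,x} = 𝔪_x`) with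
`dim 𝒪_{X,x} = 3`: `𝓘_{C̃,c′}` is generated by a pair that is part of a regular system of parameters of `𝒪_{X′,c′}`,
and if `x ∈ Y` then `𝓘_{C̃,c′} + 𝓘_Y 𝒪_{X′,c′} = 𝔪_{c′}` (`C̃` is transverse to the exceptional divisor). The hypotheses
on `C` are imposed at the single point `π c′` (pointwise companion of `exists_isRsopPart_strictTransform_of_transverse`);
proof by the chart at `c′`, see the module docstring. [cite: CossartPiltant2008, Prop. 4.4 (proof, p. 10)] -/
theorem exists_isRsopPart_strictTransform_of_transverseAt {X' X : Scheme.{u}}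
    [IsLocallyNoetherian X]
    [IsLocallyNoetherian X'] (hX : Scheme.IsRegular X) {π : X' ⟶ X} {Y : Closeds X}
    (hYreg : Scheme.IsRegular (vanishingIdeal Y).subscheme) (hπ : IsBlowup π (vanishingIdeal Y))
    {C : Closeds X} (hCirr : IsIrreducible ((C : Closeds X) : Set X)) (hCY : ¬ (C : Set X) ⊆ Y)
    {c' : X'} (hc' : c' ∈ closure (π ⁻¹' ((C : Set X) \ Y)))
    (hCreg : ∃ c : Fin 2 → X.presheaf.stalk (π c'),
      IsRsopPart c ∧ Ideal.span (Set.range c) = stalkIdeal (vanishingIdeal C) (π c'))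
    (htr : π c' ∈ (Y : Set X) →
      stalkIdeal (vanishingIdeal C) (π c') ⊔ stalkIdeal (vanishingIdeal Y) (π c') = maximalIdeal _)
    (hdim : π c' ∈ (Y : Set X) → ringKrullDim (X.presheaf.stalk (π c')) = 3) :
    (∃ c : Fin 2 → X'.presheaf.stalk c', IsRsopPart c ∧ Ideal.span (Set.range c) =
        stalkIdeal (vanishingIdeal
          (⟨closure (π ⁻¹' ((C : Set X) \ Y)), isClosed_closure⟩ : Closeds X')) c') ∧
      (π c' ∈ (Y : Set X) →
        stalkIdeal (vanishingIdeal
            (⟨closure (π ⁻¹' ((C : Set X) \ Y)), isClosed_closure⟩ : Closeds X')) c' ⊔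
          stalkIdeal ((vanishingIdeal Y).comap π) c' = maximalIdeal _) := by
  classical
  -- (0) the generic point `η` of `C` and the point `η'` of `X'` over it
  obtain ⟨η, hη⟩ := QuasiSober.sober hCirr C.isClosed
  have hηC : η ∈ (C : Set X) := hη.mem
  have hηY : η ∉ (Y : Set X) := fun h =>
    hCY (by rw [← hη.def]; exact closure_minimal (Set.singleton_subset_iff.mpr h) Y.isClosed)
  have hηs : η ∉ ((vanishingIdeal Y).support : Set X) := by
    rw [coe_support_vanishingIdeal]; exact hηY
  obtain ⟨η', hη'⟩ : ∃ η' : X', π η' = η := by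
    set W : X.Opens := ⟨((vanishingIdeal Y).support : Set X)ᶜ,
      (vanishingIdeal Y).support.isClosed.isOpen_compl⟩ with hW
    haveI : IsIso (π ∣_ W) := hπ.isIso_compl
    obtain ⟨z', hz'⟩ := (ConcreteCategory.bijective_of_isIso ((π ∣_ W).base)).2 ⟨η, hηs⟩
    refine ⟨z'.1, ?_⟩
    have := congrArg Subtype.val hz'
    rwa [morphismRestrict_base_coe] at this
  -- (1) specialisations from `η` inside `C ∖ Y` lift to `η'`: the blowing up is an open
  -- immersion on `π⁻¹(X ∖ Y)`
  have hlift : ∀ z' : X', π z' ∈ (C : Set X) \ (Y : Set X) → η' ⤳ z' := by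
    intro z' hz'
    let V : X'.Opens := π ⁻¹ᵁ centreCompl (vanishingIdeal Y)
    let F : (V : Scheme.{u}) ⟶ X := V.ι ≫ π
    haveI : IsOpenImmersion F := hπ.isOpenImmersion_preimage_compl_ι
    have hz'V : z' ∈ V := by
      change π z' ∈ ((vanishingIdeal Y).support : Set X)ᶜ
      rw [Set.mem_compl_iff, coe_support_vanishingIdeal]
      exact hz'.2
    have hη'V : η' ∈ V := by
      change π η' ∈ ((vanishingIdeal Y).support : Set X)ᶜ
      rw [hη']
      exact hηs
    have e1 : F ⟨η', hη'V⟩ = η := by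
      change π (V.ι ⟨η', hη'V⟩) = η
      rw [Scheme.Opens.ι_apply, hη']
    have e2 : F ⟨z', hz'V⟩ = π z' := by
      change π (V.ι ⟨z', hz'V⟩) = π z'
      rw [Scheme.Opens.ι_apply]
    have h1 : F ⟨η', hη'V⟩ ⤳ F ⟨z', hz'V⟩ := by
      rw [e1, e2]
      exact hη.specializes hz'.1
    have h2 : (⟨η', hη'V⟩ : V) ⤳ ⟨z', hz'V⟩ := F.isOpenEmbedding.isInducing.specializes_iff.mp h1
    have h3 := h2.map V.ι.continuous
    rwa [Scheme.Opens.ι_apply, Scheme.Opens.ι_apply] at h3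
  -- (2) the strict transform is the closure of `η'`
  have hmem' : η' ∈ π ⁻¹' ((C : Set X) \ (Y : Set X)) := by
    change π η' ∈ (C : Set X) \ (Y : Set X)
    rw [hη']
    exact ⟨hηC, hηY⟩
  have hCt : closure (π ⁻¹' ((C : Set X) \ (Y : Set X))) = closure {η'} := by
    apply le_antisymm
    · exact closure_minimal (fun z' hz' => specializes_iff_mem_closure.mp (hlift z' hz'))
        isClosed_closure
    · exact closure_minimal (Set.singleton_subset_iff.mpr (subset_closure hmem')) isClosed_closure
  have hCt' : (⟨closure (π ⁻¹' ((C : Set X) \ (Y : Set X))), isClosed_closure⟩ : Closeds X') =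
      ⟨closure {η'}, isClosed_closure⟩ := Closeds.ext hCt
  have hsp : η' ⤳ c' := specializes_iff_mem_closure.mpr (hCt ▸ hc')
  rw [hCt']
  -- (3) `𝓘_{C̃,c'}` is the kernel of `θ' : 𝒪_{X',c'} → κ(η')`
  let θ' : X'.presheaf.stalk c' →+* ResidueField (X'.presheaf.stalk η') :=
    (residue _).comp (X'.presheaf.stalkSpecializes hsp).hom
  have hker : stalkIdeal (vanishingIdeal (⟨closure {η'}, isClosed_closure⟩ : Closeds X')) c' =
      RingHom.ker θ' := by
    rw [stalkIdeal_vanishingIdeal_closure hsp, primeOfSpecializes, ← RingHom.comap_ker, ker_residue]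
  rw [hker]
  -- (4) the base point `x = π c' ∈ C`, `P = 𝓘_{C,x} = (cC)`, detected by `θ' ∘ π^*`
  have hsp0 : π η' ⤳ π c' := hsp.map π.continuous
  have hxC : π c' ∈ (C : Set X) := by
    have h := hsp0
    rw [hη'] at h
    exact hη.specializes_iff_mem.mp h
  haveI hRreg : IsRegularLocalRing (X.presheaf.stalk (π c')) := hX (π c')
  obtain ⟨cC, hcC, hcCP⟩ := hCreg
  set P : Ideal (X.presheaf.stalk (π c')) := Ideal.span (Set.range cC) with hPdef
  have hC' : C = ⟨closure {π η'}, isClosed_closure⟩ :=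
    Closeds.ext (by rw [hη']; exact hη.def.symm)
  have hPspec : stalkIdeal (vanishingIdeal C) (π c') = primeOfSpecializes hsp0 := by
    rw [hC', stalkIdeal_vanishingIdeal_closure hsp0]
  have hPθ : ∀ r, θ' ((π.stalkMap c').hom r) = 0 ↔ r ∈ P := by
    intro r
    rw [hcCP, hPspec]
    change residue _ ((X'.presheaf.stalkSpecializes hsp).hom ((π.stalkMap c').hom r)) = 0 ↔
      (X.presheaf.stalkSpecializes hsp0).hom r ∈ maximalIdeal _
    have hnat := Scheme.Hom.stalkSpecializes_stalkMap_apply π η' c' hsp r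
    erw [← hnat]
    rw [residue_eq_zero_iff, IsLocalRing.mem_maximalIdeal, IsLocalRing.mem_maximalIdeal,
      mem_nonunits_iff, mem_nonunits_iff]
    exact (isUnit_map_iff (π.stalkMap η').hom _).not
  by_cases hxY : π c' ∈ (Y : Set X)
  swap
  · -- off the centre: `π^*_{c'}` is an isomorphism carrying `𝓘_{C,x} = (cC)` to `𝓘_{C̃,c'}`
    refine ⟨?_, fun h => absurd h hxY⟩
    haveI : IsIso (π.stalkMap c') :=
      hπ.isIso_stalkMap_of_not_mem_support
        (by rw [← SetLike.mem_coe, coe_support_vanishingIdeal]; exact hxY)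
    let e : X.presheaf.stalk (π c') ≃+* X'.presheaf.stalk c' :=
      (asIso (π.stalkMap c')).commRingCatIsoToRingEquiv
    have he : ∀ r, e r = (π.stalkMap c').hom r := fun r => rfl
    refine ⟨e ∘ cC, hcC.map_ringEquiv e, ?_⟩
    rw [Set.range_comp, ← Ideal.map_span e]
    ext z
    obtain ⟨r, rfl⟩ := e.surjective z
    rw [Ideal.apply_mem_of_equiv_iff, RingHom.mem_ker, he, hPθ]
  · -- over the centre `x = π c' ∈ C ∩ Y`
    have hd3 : ringKrullDim (X.presheaf.stalk (π c')) = 3 := hdim hxY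
    obtain ⟨h, q₀, hq₀, hq₀Y⟩ := exists_isRsopPart_span_range_eq_stalkIdeal_of_mem_closeds hYreg hxY
    have hPQ : P ⊔ Ideal.span (Set.range q₀) = maximalIdeal _ := by
      rw [hcCP, hq₀Y]
      exact htr hxY
    -- (5) `D = 𝒪_{X,x}/P` is a discrete valuation ring with `𝔪_D = (q₀) D`
    haveI hDreg : IsRegularLocalRing (X.presheaf.stalk (π c') ⧸ P) := hcC.isRegularLocalRing_quotient
    haveI hDdom : IsDomain (X.presheaf.stalk (π c') ⧸ P) := isDomain_of_isRegularLocalRing _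
    have hdimD : ringKrullDim (X.presheaf.stalk (π c') ⧸ P) = 1 := by
      have h1 := hcC.ringKrullDim_quotient_add
      rw [hd3] at h1
      obtain ⟨k, hk⟩ := exists_nat_cast_eq_ringKrullDim (R := X.presheaf.stalk (π c') ⧸ P)
      rw [hk] at h1 ⊢
      have h2 : k + 2 = 3 := by exact_mod_cast h1
      have h3 : k = 1 := by omega
      subst h3
      rfl
    haveI hDVR : IsDiscreteValuationRing (X.presheaf.stalk (π c') ⧸ P) :=
      Literature.RingTheory.RegularLocalRing.isDiscreteValuationRing_of_ringKrullDim_eq_one hdimD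
    have hmD : Ideal.span (Set.range (Ideal.Quotient.mk P ∘ q₀)) =
        maximalIdeal (X.presheaf.stalk (π c') ⧸ P) := by
      rw [maximalIdeal_quotient_eq_map P, ← hPQ, Ideal.map_sup, Ideal.map_quotient_self, bot_sup_eq,
        Ideal.map_span, ← Set.range_comp]
    obtain ⟨j₀, hj₀⟩ := exists_span_singleton_eq_maximalIdeal_of_span_range_eq _ hmD
    -- every element of `𝔪_x` is a multiple of `q₀ j₀` modulo `P`
    have hdiv : ∀ r ∈ maximalIdeal (X.presheaf.stalk (π c')), ∃ b, r - b * q₀ j₀ ∈ P := by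
      intro r hr
      have h1 : Ideal.Quotient.mk P r ∈ Ideal.span {Ideal.Quotient.mk P (q₀ j₀)} := by
        rw [show Ideal.Quotient.mk P (q₀ j₀) = (Ideal.Quotient.mk P ∘ q₀) j₀ from rfl, hj₀,
          maximalIdeal_quotient_eq_map P]
        exact Ideal.mem_map_of_mem _ hr
      obtain ⟨b', hb'⟩ := Ideal.mem_span_singleton'.mp h1
      obtain ⟨b, rfl⟩ := Ideal.Quotient.mk_surjective b'
      refine ⟨b, ?_⟩
      rw [← Ideal.Quotient.eq_zero_iff_mem, map_sub, map_mul, hb', sub_self]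
    have hq₀j : q₀ j₀ ∉ P := by
      intro hmem
      apply IsDiscreteValuationRing.not_a_field (X.presheaf.stalk (π c') ⧸ P)
      rw [← hj₀, Ideal.span_singleton_eq_bot]
      exact Ideal.Quotient.eq_zero_iff_mem.mpr hmem
    -- the centre has positive codimension: `h = m + 1`
    obtain ⟨m, rfl⟩ : ∃ m, h = m + 1 := ⟨h - 1, (Nat.succ_pred_eq_of_pos (Fin.pos j₀)).symm⟩
    -- shear `q₀`: `q_i ∈ P` for `i ≠ j₀`, `q_{j₀} = q₀ j₀`
    choose d hd using fun i : {i : Fin (m + 1) // i ≠ j₀} => hdiv (q₀ i.1) (hq₀.mem_maximalIdeal i.1)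
    set q : Fin (m + 1) → X.presheaf.stalk (π c') := shiftRsop q₀ j₀ d with hqdef
    have hq : IsRsopPart q := isRsopPart_shiftRsop hq₀ j₀ d
    have hqY : Ideal.span (Set.range q) = stalkIdeal (vanishingIdeal Y) (π c') := by
      rw [hqdef, span_range_shiftRsop, hq₀Y]
    have hqj : q j₀ = q₀ j₀ := shiftRsop_self _ _ _
    have hqP : ∀ i, i ≠ j₀ → q i ∈ P := fun i hi => by
      rw [hqdef, shiftRsop_of_ne _ _ _ hi]
      exact hd ⟨i, hi⟩
    have hqjP : q j₀ ∉ P := by rw [hqj]; exact hq₀j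
    -- complete `q` to a regular system of parameters `(q, w)` with `w ⊆ P`
    obtain ⟨e, xx, hdR, hxx, hxxq⟩ := hq.exists_rsop
    have hxxm : ∀ i, xx i ∈ maximalIdeal _ := fun i => hxx ▸ Ideal.subset_span ⟨i, rfl⟩
    choose b hb using fun k : Fin e => hdiv (xx (Fin.natAdd (m + 1) k)) (hxxm _)
    let w : Fin e → X.presheaf.stalk (π c') := fun k => xx (Fin.natAdd (m + 1) k) - b k * q₀ j₀
    have hwP : ∀ k, w k ∈ P := hb
    have hz : Ideal.span (Set.range (Fin.append q w)) = maximalIdeal _ := by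
      apply le_antisymm
      · rw [Ideal.span_le]
        rintro _ ⟨i, rfl⟩
        refine Fin.addCases (fun i => ?_) (fun k => ?_) i
        · rw [Fin.append_left]
          exact hq.mem_maximalIdeal i
        · rw [Fin.append_right]
          exact sub_mem (hxxm _) (Ideal.mul_mem_left _ _ (hq₀.mem_maximalIdeal j₀))
      · rw [← hxx, Ideal.span_le]
        rintro _ ⟨i, rfl⟩
        refine Fin.addCases (fun i => ?_) (fun k => ?_) i
        · rw [hxxq]
          exact Ideal.subset_span ⟨Fin.castAdd e i, by rw [Fin.append_left]⟩
        · have hk : xx (Fin.natAdd (m + 1) k) = w k + b k * q₀ j₀ := by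
            simp only [w, sub_add_cancel]
          rw [hk]
          exact add_mem (Ideal.subset_span ⟨Fin.natAdd (m + 1) k, by rw [Fin.append_right]⟩)
            (Ideal.mul_mem_left _ _
              (Ideal.subset_span ⟨Fin.castAdd e j₀, by rw [Fin.append_left, hqj]⟩))
    have hme : m + e = 2 := by
      have hR3 : ((maximalIdeal (X.presheaf.stalk (π c'))).spanFinrank : WithBot ℕ∞) = (3 : ℕ) := by
        rw [IsRegularLocalRing.spanFinrank_maximalIdeal, hd3]
        rfl
      rw [hdR] at hR3
      have : m + 1 + e = 3 := by exact_mod_cast hR3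
      omega
    -- (6) a chart presentation of `𝒪_{X',c'}`; the chart index is `j₀` and `c'` is the origin
    obtain ⟨j, 𝔴, χ, hχ, hloc, h𝔴⟩ := hπ.exists_reesChart_stalk c' q hqY
    letI := χ.toAlgebra
    haveI : IsLocalization.AtPrime (X'.presheaf.stalk c') 𝔴.asIdeal := hloc
    have halg : ∀ b, (algebraMap (chartRing q j) (X'.presheaf.stalk c') :
        chartRing q j →+* X'.presheaf.stalk c') b = χ b := fun b => rfl
    have hχP : ∀ r, θ' (χ (chartBase q j r)) = 0 ↔ r ∈ P := fun r => by rw [hχ]; exact hPθ r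
    have hkerw : ∀ b, θ' (χ b) = 0 → b ∈ 𝔴.asIdeal := by
      intro b hb
      have h1 : χ b ∈ maximalIdeal (X'.presheaf.stalk c') :=
        IsLocalRing.le_maximalIdeal (RingHom.ker_ne_top θ') hb
      exact (IsLocalization.AtPrime.to_map_mem_maximal_iff (X'.presheaf.stalk c') 𝔴.asIdeal b).mp h1
    have hjj : j = j₀ := by
      by_contra hne
      apply hqjP
      rw [← hχP]
      have h0 : θ' (χ (chartBase q j (q j))) = 0 := (hχP _).mpr (hqP j hne)
      rw [reesChartBase_apply_eq_mul_chartGen q j j₀, map_mul, map_mul, h0, zero_mul]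
    subst hjj
    have hθj : θ' (χ (chartBase q j (q j))) ≠ 0 := fun h0 => hqjP ((hχP _).mp h0)
    have horig : ∀ i, i ≠ j → θ' (χ (chartGen q j i)) = 0 := by
      intro i hi
      have h1 : θ' (χ (chartBase q j (q i))) = 0 := (hχP _).mpr (hqP i hi)
      rw [reesChartBase_apply_eq_mul_chartGen q j i, map_mul, map_mul] at h1
      exact (mul_eq_zero.mp h1).resolve_left hθj
    have he' : ∀ i, i ≠ j → chartGen q j i ∈ 𝔴.asIdeal := fun i hi => hkerw _ (horig i hi)
    have hθw : ∀ k, θ' (χ (chartBase q j (w k))) = 0 := fun k => (hχP _).mpr (hwP k)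
    -- (7) the regular parameters of `𝒪_{X',c'}` and the two conclusions
    obtain ⟨c, hc, hcker, hsup⟩ := exists_isRsopPart_span_eq_ker_of_origin q j w hz hdR 𝔴.asIdeal
      h𝔴 he' (X'.presheaf.stalk c') θ' horig hθw hθj
    refine ⟨⟨c ∘ finCongr hme.symm, hc.comp _ (finCongr hme.symm).injective, ?_⟩, fun _ => ?_⟩
    · rw [(finCongr hme.symm).surjective.range_comp, hcker]
    · rw [stalkIdeal_comap_eq_map_stalkMap]
      apply le_antisymm
      · refine sup_le (IsLocalRing.le_maximalIdeal (RingHom.ker_ne_top θ')) ?_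
        rw [Ideal.map_le_iff_le_comap]
        intro r hr
        exact Ideal.mem_comap.mpr (map_nonunit _ r ((hqY ▸ hq.span_range_le_maximalIdeal) hr))
      · rw [← hsup]
        refine sup_le_sup_left ?_ _
        rw [Ideal.span_singleton_le_iff_mem, halg, hχ]
        exact Ideal.mem_map_of_mem _ (hqY ▸ Ideal.subset_span ⟨j, rfl⟩)

end Scheme

end Literature.AlgebraicGeometry.Resolution

end
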